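import Mathlib
import Summits.Ventures.PercRepro.TriangleCapBandComplete

/-!
# PercRepro — THE ONE-SIDED COVERING, THE COMPLETE BAND FOR EVERY `ℓ ≤ t`, AND: THE BAND ON `n` VERTICES IS AN
INTERVAL IFF `ℓ ≥ t − 2` (p3, gen 53; part 272)

The two-sided covering of part 263 fills a sub-band with `e` non-leaf star ends and `c` shared leaves at once, which
costs the room `c + e ≤ t − u` in the star of `x` and hence the hypothesis `ℓ + u ≤ t + 1`.  THE ONE-SIDED COVERING
(`cover_one_sided`): the left staircase `E v` (steps `≤ 2 u`, from `E 0` down to `E u = 2 u`) reaches every even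
`2 m ≤ E 0 + 2 c'` with `e` and `c` NEVER BOTH POSITIVE — above `E 0` by `e` alone, below it by `c < u` alone (the
largest `v` with `E v ≥ 2 m`).  So every sub-band interval `[B(u), B(u) + W(u, ℓ)]` is attained as soon as `2 u ≤ t`
and `ℓ ≤ t + 1` (`subband_interval'`, `subband_attained'`), and the chains of parts 268–269 run under `2 ≤ ℓ ≤ t`
alone: `band_shallow_chain'`, `band_deep_complete'` (one interval from `B(u₁)` to the extremal value) and
**`band_complete'`** (the complete band, hypotheses `2 ≤ ℓ ≤ t`, `1 ≤ u₁`, `2 u₁ ≤ t`, `ℓ + u₁ ≤ t`, the overlap at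
`u₁`, `4 (u₁ − 1) + 3 ≤ t ∨ ℓ u₁ < t`).

THE FULL INTERVAL: for `t − 2 ≤ ℓ ≤ t` the chain starts at the star sub-band `u = 0` (`[0, ℓ − 1]`, overlapping
`B(1) = t − 2`), so EVERY `j` up to the extremal value is attained (`band_full_of_le`); with the first gap of part 253
(`ℓ ≤ j ≤ t − 3` is never attained): **THE BAND `t` ON `ℓ + 1 + (s − t)` VERTICES (`2 ≤ ℓ ≤ t`, `2 t ≤ s`) IS AN
INTERVAL IFF `t ≤ ℓ + 2`** (`band_interval_iff`).  Axioms: standard.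
-/

namespace PercRepro

namespace TriangleCap

namespace C047

open Finset

/-- **THE ONE-SIDED COVERING LEMMA:** `E u = 2 u`, `E` even, `E v ≤ E (v + 1) + 2 u`: every even `2 m ≤ E 0 + 2 c′` is
`2 e + E v − 2 c` with `v ≤ u`, `e ≤ c′`, `c ≤ u` and `e = 0 ∨ c = 0`. -/
theorem cover_one_sided (u c' : ℕ) (E : ℕ → ℕ) (hEu : E u = 2 * u) (hEeven : ∀ v, Even (E v))
    (hstep : ∀ v, v < u → E v ≤ E (v + 1) + 2 * u) :
    ∀ k, k ≤ u → ∀ m, 2 * m ≤ E (u - k) + 2 * c' →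
      ∃ v, u - k ≤ v ∧ v ≤ u ∧ ∃ e, e ≤ c' ∧ ∃ c, c ≤ u ∧ 2 * m + 2 * c = 2 * e + E v ∧ (e = 0 ∨ c = 0) := by
  intro k
  induction k with
  | zero =>
    intro _ m hm
    rw [Nat.sub_zero, hEu] at hm
    rcases Nat.lt_or_ge m u with h | h
    · exact ⟨u, le_rfl, le_rfl, 0, Nat.zero_le _, u - m, by omega, by rw [hEu]; omega, Or.inl rfl⟩
    · exact ⟨u, le_rfl, le_rfl, m - u, by omega, 0, Nat.zero_le _, by rw [hEu]; omega, Or.inr rfl⟩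
  | succ k ih =>
    intro hk m hm
    by_cases hcase : 2 * m ≤ E (u - k) + 2 * c'
    · obtain ⟨v, h1, h2, e, he, c, hc, hmc, hor⟩ := ih (by omega) m hcase
      exact ⟨v, by omega, h2, e, he, c, hc, hmc, hor⟩
    · have hstep' := hstep (u - (k + 1)) (by omega)
      have e1 : u - (k + 1) + 1 = u - k := by omega
      rw [e1] at hstep'
      obtain ⟨x, hx⟩ := hEeven (u - (k + 1))
      rcases Nat.lt_or_ge (2 * m) (E (u - (k + 1))) with hlt | hge
      · -- below the step: `c = (E v − 2 m)/2 < u` shared leaves, no non-leaf end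
        refine ⟨u - (k + 1), le_rfl, by omega, 0, Nat.zero_le _, (E (u - (k + 1)) - 2 * m) / 2, by omega, by omega,
          Or.inl rfl⟩
      · -- at or above the step: `e = (2 m − E v)/2 ≤ c′` non-leaf ends, no shared leaf
        refine ⟨u - (k + 1), le_rfl, by omega, (2 * m - E (u - (k + 1))) / 2, by omega, 0, Nat.zero_le _, by omega,
          Or.inr rfl⟩

/-- **EVERY SUB-BAND IS AN INTERVAL (`k` carriers), `ℓ ≤ t + 1`:** for `1 ≤ k`, `k + 1 ≤ ℓ`, `1 ≤ u`, `2 u ≤ t`,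
`ℓ + u ≤ t + k + 1`, `2 t ≤ s`, every `j` with `u (t − u − 1) ≤ j` and
`2 j ≤ 2 u (t − u − 1) + (u (u + 1) − coll u (lfRR k 0)) + 2 (ℓ − 1 − k)` is attained on `ℓ + 1 + (s − t)` vertices. -/
theorem subband_interval' (ℓ s t u k j : ℕ) (hk : 1 ≤ k) (hkℓ : k + 1 ≤ ℓ) (hu : 1 ≤ u)
    (hut : 2 * u ≤ t) (hℓt : ℓ + u ≤ t + k + 1) (hs : 2 * t ≤ s) (hj1 : u * (t - u - 1) ≤ j)
    (hj2 : 2 * j ≤ 2 * (u * (t - u - 1)) + (u * (u + 1) - coll u (lfRR k 0)) + 2 * (ℓ - 1 - k)) :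
    ∃ (H : SimpleGraph (Fin (ℓ + 1 + (s - t)))) (_ : DecidableRel H.Adj), H.CliqueFree 3 ∧
      H.edgeFinset.card = s ∧ (∃ w, deg H w + t = s) ∧
      ∑ v, deg H v * deg H v + 2 * (t * (s - t - 1)) + 2 * j = s * (s + 1) := by
  obtain ⟨m, rfl⟩ : ∃ m, j = u * (t - u - 1) + m := ⟨j - u * (t - u - 1), by omega⟩
  have hle : ∀ v, coll u (lfRR k v) ≤ u * (u - 1) := fun v => coll_le u _
  have hu1 : u * (u - 1) + 2 * u = u * (u + 1) := by
    obtain ⟨u', rfl⟩ : ∃ u', u = u' + 1 := ⟨u - 1, by omega⟩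
    rw [Nat.add_sub_cancel]
    ring
  have hcover := cover_one_sided u (ℓ - 1 - k) (fun v => u * (u + 1) - coll u (lfRR k v))
    (by show u * (u + 1) - coll u (lfRR k u) = 2 * u; rw [coll_lfRR_top]; omega)
    (fun v => by
      obtain ⟨x, hx⟩ := coll_even u (lfRR k v)
      obtain ⟨d, hd⟩ := Nat.even_mul_succ_self u
      have := hle v
      exact ⟨d - x, by omega⟩)
    (fun v _ => by
      have h1 := coll_le_coll_add_of_eq_off u (lfRR k (v + 1)) (lfRR k v) v (fun i _ hi => lfRR_eq_off k v i hi)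
      have := hle v
      have := hle (v + 1)
      show u * (u + 1) - coll u (lfRR k v) ≤ u * (u + 1) - coll u (lfRR k (v + 1)) + 2 * u
      omega)
    u le_rfl m (by
      show 2 * m ≤ u * (u + 1) - coll u (lfRR k (u - u)) + 2 * (ℓ - 1 - k)
      rw [Nat.sub_self]
      have := hle 0
      omega)
  obtain ⟨v, -, -, e, he, c, hc, hmc, hor⟩ := hcover
  have hce : c + e ≤ t - u := by
    rcases hor with rfl | rfl
    · omega
    · omega
  have hw := interiorWitness ℓ s t u k v e c hk (by omega) hu hut hc hce hs
  have hv := hle v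
  have e5 : 2 * e + 2 * (u * (t - u - 1)) + u * (u + 1) - coll u (lfRR k v) - 2 * c =
      2 * (u * (t - u - 1) + m) := by omega
  rw [e5] at hw
  exact hw

/-- **EVERY SUB-BAND INTERVAL IS ATTAINED, `ℓ ≤ t + 1`:** for `2 ≤ ℓ`, `1 ≤ u`, `2 u ≤ t`, `ℓ ≤ t + 1`, `2 t ≤ s`, every
`j` with `u (t − u − 1) ≤ j` and `2 j ≤ 2 u (t − u − 1) + twoW ℓ u` is attained on `ℓ + 1 + (s − t)` vertices. -/
theorem subband_attained' (ℓ s t u j : ℕ) (hℓ : 2 ≤ ℓ) (hu : 1 ≤ u) (hut : 2 * u ≤ t) (hℓt : ℓ ≤ t + 1)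
    (hs : 2 * t ≤ s) (hj1 : u * (t - u - 1) ≤ j) (hj2 : 2 * j ≤ 2 * (u * (t - u - 1)) + twoW ℓ u) :
    ∃ (H : SimpleGraph (Fin (ℓ + 1 + (s - t)))) (_ : DecidableRel H.Adj), H.CliqueFree 3 ∧
      H.edgeFinset.card = s ∧ (∃ w, deg H w + t = s) ∧
      ∑ v, deg H v * deg H v + 2 * (t * (s - t - 1)) + 2 * j = s * (s + 1) := by
  unfold twoW at hj2
  by_cases hcase : u ≤ ℓ - 1
  · apply subband_interval' ℓ s t u u j hu (by omega) hu hut (by omega) hs hj1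
    rw [coll_lfRR_zero u u hu, Nat.div_self hu, Nat.mod_self]
    simp only [Nat.sub_self, mul_zero, zero_mul, add_zero, Nat.sub_zero]
    have hc := coll_le u (lfRR (ℓ - 1) 0)
    have hu1 : u * (u - 1) ≤ u * (u + 1) := Nat.mul_le_mul_left u (by omega)
    omega
  · apply subband_interval' ℓ s t u (ℓ - 1) j (by omega) (by omega) hu hut (by omega) hs hj1
    have e : ℓ - 1 - (ℓ - 1) = 0 := Nat.sub_self _
    have e' : ℓ - 1 - u = 0 := by omega
    rw [e]
    rw [e'] at hj2
    omega

/-- The star sub-band: `twoW ℓ 0 = 2 (ℓ − 1)`. -/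
theorem twoW_zero (ℓ : ℕ) : twoW ℓ 0 = 2 * (ℓ - 1) := by
  unfold twoW
  have := coll_le 0 (lfRR (ℓ - 1) 0)
  omega

/-- **THE SHALLOW CHAIN, `ℓ ≤ t + 1`:** for `2 ≤ ℓ`, `u₁ ≤ u₂`, `2 u₂ ≤ t`, `ℓ ≤ t + 1`, `2 t ≤ s` and the overlap at
`u₁` (the star sub-band `u₁ = 0` allowed), every `j` from `B(u₁)` to the top of the sub-band `u₂` is attained on
`ℓ + 1 + (s − t)` vertices. -/
theorem band_shallow_chain' (ℓ s t u₁ u₂ : ℕ) (hℓ : 2 ≤ ℓ) (hu12 : u₁ ≤ u₂) (hut : 2 * u₂ ≤ t)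
    (hℓt : ℓ ≤ t + 1) (hs : 2 * t ≤ s)
    (hov : 2 * ((u₁ + 1) * (t - u₁ - 2)) ≤ 2 * (u₁ * (t - u₁ - 1)) + twoW ℓ u₁ + 2) :
    ∀ j, u₁ * (t - u₁ - 1) ≤ j → 2 * j ≤ 2 * (u₂ * (t - u₂ - 1)) + twoW ℓ u₂ →
      ∃ (H : SimpleGraph (Fin (ℓ + 1 + (s - t)))) (_ : DecidableRel H.Adj), H.CliqueFree 3 ∧
        H.edgeFinset.card = s ∧ (∃ w, deg H w + t = s) ∧
        ∑ v, deg H v * deg H v + 2 * (t * (s - t - 1)) + 2 * j = s * (s + 1) := by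
  intro j hj1 hj2
  have hchain := chain_attained (fun j => ∃ (H : SimpleGraph (Fin (ℓ + 1 + (s - t)))) (_ : DecidableRel H.Adj),
      H.CliqueFree 3 ∧ H.edgeFinset.card = s ∧ (∃ w, deg H w + t = s) ∧
      ∑ v, deg H v * deg H v + 2 * (t * (s - t - 1)) + 2 * j = s * (s + 1))
    (fun u => u * (t - u - 1)) (fun u => (2 * (u * (t - u - 1)) + twoW ℓ u) / 2) u₁ u₂ hu12 ?_ ?_ j hj1 ?_
  · exact hchain
  · intro u hu1 hu2 j hj1 hj2
    rcases Nat.eq_zero_or_pos u with rfl | hu0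
    · -- the star sub-band `[0, ℓ − 1]`
      rw [twoW_zero] at hj2
      exact starWitness ℓ s t j (by omega) hs (by omega) (by omega)
    · exact subband_attained' ℓ s t u j hℓ hu0 (by omega) hℓt hs hj1 (by omega)
  · intro u hu1 hu2
    have := overlap_of_le ℓ t u₁ hov u hu1
    have e : t - (u + 1) - 1 = t - u - 2 := by omega
    rw [e]
    omega
  · omega

/-- **ONE INTERVAL FROM `B(u₁)` TO THE EXTREMAL VALUE, `ℓ ≤ t`:** for `2 ≤ ℓ ≤ t`, `2 u₁ ≤ t`, `2 t ≤ s` and the overlap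
at `u₁`, every `j` with `u₁ (t − u₁ − 1) ≤ j` and `2 j + 2 (t / ℓ) t ≤ t (t − 1) + ℓ (t / ℓ)(t / ℓ + 1)` is attained on
`ℓ + 1 + (s − t)` vertices. -/
theorem band_deep_complete' (ℓ s t u₁ : ℕ) (hℓ : 2 ≤ ℓ) (hℓt : ℓ ≤ t) (hut : 2 * u₁ ≤ t) (hs : 2 * t ≤ s)
    (hov : 2 * ((u₁ + 1) * (t - u₁ - 2)) ≤ 2 * (u₁ * (t - u₁ - 1)) + twoW ℓ u₁ + 2) :
    ∀ j, u₁ * (t - u₁ - 1) ≤ j → 2 * j + 2 * (t / ℓ) * t ≤ t * (t - 1) + ℓ * ((t / ℓ) * (t / ℓ + 1)) →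
      ∃ (H : SimpleGraph (Fin (ℓ + 1 + (s - t)))) (_ : DecidableRel H.Adj), H.CliqueFree 3 ∧
        H.edgeFinset.card = s ∧ (∃ w, deg H w + t = s) ∧
        ∑ v, deg H v * deg H v + 2 * (t * (s - t - 1)) + 2 * j = s * (s + 1) := by
  intro j hj1 hj2
  by_cases hcase : 2 * j ≤ 2 * ((t / 2) * (t - t / 2 - 1)) + twoW ℓ (t / 2)
  · exact band_shallow_chain' ℓ s t u₁ (t / 2) hℓ (by omega) (by omega) (by omega) hs hov j hj1 hcase
  · have := deepTop_le_twoW ℓ t (t / 2)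
    exact band_above_half_attained ℓ s t hℓ hℓt hs j (by omega) hj2

/-- **THE COMPLETE BAND ON `n` VERTICES, `ℓ ≤ t`:** for `2 ≤ ℓ ≤ t`, `2 t ≤ s`, `1 ≤ u₁`, `2 u₁ ≤ t`, `ℓ + u₁ ≤ t`, the
overlap `2 B(u₁ + 1) ≤ 2 B(u₁) + twoW ℓ u₁ + 2` and `4 (u₁ − 1) + 3 ≤ t ∨ ℓ u₁ < t`: the band value `2 j` is attained
on `ℓ + 1 + (s − t)` vertices IFF either `j < B(u₁)` and `j` lies in a sub-band interval `u < u₁`, or `B(u₁) ≤ j` and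
`2 j + 2 (t / ℓ) t ≤ t (t − 1) + ℓ (t / ℓ)(t / ℓ + 1)`. -/
theorem band_complete' (ℓ s t u₁ j : ℕ) (hℓ : 2 ≤ ℓ) (hℓt : ℓ ≤ t) (hs : 2 * t ≤ s) (hu : 1 ≤ u₁) (hut : 2 * u₁ ≤ t)
    (hℓu : ℓ + u₁ ≤ t)
    (hov : 2 * ((u₁ + 1) * (t - u₁ - 2)) ≤ 2 * (u₁ * (t - u₁ - 1)) + twoW ℓ u₁ + 2)
    (hstruct : 4 * (u₁ - 1) + 3 ≤ t ∨ ℓ * u₁ < t) :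
    (∃ (H : SimpleGraph (Fin (ℓ + 1 + (s - t)))) (_ : DecidableRel H.Adj), H.CliqueFree 3 ∧
      H.edgeFinset.card = s ∧ (∃ w, deg H w + t = s) ∧
      ∑ v, deg H v * deg H v + 2 * (t * (s - t - 1)) + 2 * j = s * (s + 1)) ↔
    ((j < u₁ * (t - u₁ - 1) ∧ ∃ u, u + 1 ≤ u₁ ∧ u * (t - u - 1) ≤ j ∧
        2 * j + 2 * (subQ ℓ u * u) ≤ 2 * (u * (t - u - 1)) + u * (u + 1) + (ℓ - 1) * (subQ ℓ u * (subQ ℓ u + 1))) ∨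
      (u₁ * (t - u₁ - 1) ≤ j ∧ 2 * j + 2 * (t / ℓ) * t ≤ t * (t - 1) + ℓ * ((t / ℓ) * (t / ℓ + 1)))) := by
  have hexact : j < u₁ * (t - u₁ - 1) →
      ((∃ (H : SimpleGraph (Fin (ℓ + 1 + (s - t)))) (_ : DecidableRel H.Adj), H.CliqueFree 3 ∧
        H.edgeFinset.card = s ∧ (∃ w, deg H w + t = s) ∧
        ∑ v, deg H v * deg H v + 2 * (t * (s - t - 1)) + 2 * j = s * (s + 1)) ↔
      ∃ u, u ≤ u₁ - 1 ∧ u * (t - u - 1) ≤ j ∧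
        2 * j + 2 * (subQ ℓ u * u) ≤ 2 * (u * (t - u - 1)) + u * (u + 1) + (ℓ - 1) * (subQ ℓ u * (subQ ℓ u + 1))) := by
    intro hj
    have e1 : u₁ - 1 + 1 = u₁ := by omega
    have e2 : t - (u₁ - 1) - 2 = t - u₁ - 1 := by omega
    rcases hstruct with h4 | hℓ1
    · exact band_exact ℓ s t (u₁ - 1) j hℓ h4 (by omega) hs (by rw [e1, e2]; exact hj)
    · exact band_exact' ℓ s t (u₁ - 1) j hℓ (by rw [e1]; exact hℓ1) (by omega) hs (by rw [e1, e2]; exact hj)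
  constructor
  · intro hatt
    rcases Nat.lt_or_ge j (u₁ * (t - u₁ - 1)) with hj | hj
    · left
      obtain ⟨u, hu0, hlow, hup⟩ := (hexact hj).mp hatt
      exact ⟨hj, u, by omega, hlow, hup⟩
    · right
      refine ⟨hj, ?_⟩
      obtain ⟨H, _, hfree, hs', ⟨w, hw⟩, hj'⟩ := hatt
      exact ((vertex_band_extremal ℓ s t (by omega) (by omega) hs).1 H hfree hs' w hw j hj').2.2 hℓt
  · rintro (⟨hj, u, hu0, hlow, hup⟩ | ⟨hj, hmax⟩)
    · exact (hexact hj).mpr ⟨u, by omega, hlow, hup⟩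
    · exact band_deep_complete' ℓ s t u₁ hℓ hℓt hut hs hov j hj hmax

/-- **THE FULL INTERVAL:** for `2 ≤ ℓ ≤ t ≤ ℓ + 2`, `2 t ≤ s`, every `j` with
`2 j + 2 (t / ℓ) t ≤ t (t − 1) + ℓ (t / ℓ)(t / ℓ + 1)` is attained on `ℓ + 1 + (s − t)` vertices — the star sub-band
`[0, ℓ − 1]` already overlaps `B(1) = t − 2`. -/
theorem band_full_of_le (ℓ s t : ℕ) (hℓ : 2 ≤ ℓ) (hℓt : ℓ ≤ t) (htℓ : t ≤ ℓ + 2) (hs : 2 * t ≤ s) :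
    ∀ j, 2 * j + 2 * (t / ℓ) * t ≤ t * (t - 1) + ℓ * ((t / ℓ) * (t / ℓ + 1)) →
      ∃ (H : SimpleGraph (Fin (ℓ + 1 + (s - t)))) (_ : DecidableRel H.Adj), H.CliqueFree 3 ∧
        H.edgeFinset.card = s ∧ (∃ w, deg H w + t = s) ∧
        ∑ v, deg H v * deg H v + 2 * (t * (s - t - 1)) + 2 * j = s * (s + 1) := by
  intro j hj
  have hov : 2 * ((0 + 1) * (t - 0 - 2)) ≤ 2 * (0 * (t - 0 - 1)) + twoW ℓ 0 + 2 := by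
    rw [twoW_zero]
    omega
  by_cases hcase : 2 * j ≤ 2 * ((t / 2) * (t - t / 2 - 1)) + twoW ℓ (t / 2)
  · exact band_shallow_chain' ℓ s t 0 (t / 2) hℓ (Nat.zero_le _) (by omega) (by omega) hs hov j (by omega) hcase
  · have := deepTop_le_twoW ℓ t (t / 2)
    exact band_above_half_attained ℓ s t hℓ hℓt hs j (by omega) hj

/-- **THE BAND ON `n` VERTICES IS AN INTERVAL IFF `ℓ ≥ t − 2`:** for `2 ≤ ℓ ≤ t`, `2 t ≤ s`, every `j` up to the extremal
value `2 j + 2 (t / ℓ) t ≤ t (t − 1) + ℓ (t / ℓ)(t / ℓ + 1)` is attained on `ℓ + 1 + (s − t)` vertices IFF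
`t ≤ ℓ + 2` (otherwise `j = ℓ` is the first gap, part 253). -/
theorem band_interval_iff (ℓ s t : ℕ) (hℓ : 2 ≤ ℓ) (hℓt : ℓ ≤ t) (hs : 2 * t ≤ s) :
    (∀ j, 2 * j + 2 * (t / ℓ) * t ≤ t * (t - 1) + ℓ * ((t / ℓ) * (t / ℓ + 1)) →
      ∃ (H : SimpleGraph (Fin (ℓ + 1 + (s - t)))) (_ : DecidableRel H.Adj), H.CliqueFree 3 ∧
        H.edgeFinset.card = s ∧ (∃ w, deg H w + t = s) ∧
        ∑ v, deg H v * deg H v + 2 * (t * (s - t - 1)) + 2 * j = s * (s + 1)) ↔ t ≤ ℓ + 2 := by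
  constructor
  · intro hall
    by_contra hlt
    -- `j = t − 2` is attained (the bottom of the sub-band `1`), so `j = ℓ ≤ t − 3` satisfies the extremal bound
    obtain ⟨H, _, hfree, hs', ⟨w, hw⟩, hj'⟩ := subband_attained' ℓ s t 1 (t - 2) hℓ le_rfl (by omega) (by omega) hs
      (by omega) (by omega)
    have hb := ((vertex_band_extremal ℓ s t (by omega) (by omega) hs).1 H hfree hs' w hw (t - 2) hj').2.2 hℓt
    have hatt := hall ℓ (by omega)
    exact first_gap_not_attained ℓ s t ℓ (by omega) hs le_rfl (by omega) hatt
  · intro h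
    exact band_full_of_le ℓ s t hℓ hℓt h hs

end C047

end TriangleCap

end PercRepro
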